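import Summits.HodgeConjecture.HodgeConjecture.Theorems.SignSymmetricPowersConfluenceLinkG
import Summits.HodgeConjecture.HodgeConjecture.Theorems.SignSymmetricPowersLinkConfluenceNKeyed
import Literature.AlgebraicGeometry.HodgeTheory.SignSymmetricLinkOfNonOrthogonalConfluenceTwoCoeff
import Literature.AlgebraicGeometry.HodgeTheory.NodalFormPencilNonsingular
import HarnessLib

/-!
# LINK-G of crux K1-B from the KEYED Picard–Lefschetz binders {hPL₁, hPL₂exch} and hN (P3 g34 DECISION 2026-08-28T22:46:09Z)

Prover seat `hodge-nonav-19716-p2` (g10), cell `hodge-nonav`; helper `--supports stmt-HodgeConjecture-19716`; sorry-free, no definition,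
no new named fact.  `signConfluenceLinkG_of_nonComm_keyed` = `SignSymmetricPowersConfluenceLinkGN.signConfluenceLinkG_of_nonComm` (g9) with the
antecedent `picardLefschetz_nodalForms_uniform` REPLACED by the two keyed binders `picardLefschetz_oneNode` (hPL₁) and
`picardLefschetz_exchangedPair` (hPL₂exch) of `Literature/…/PicardLefschetzNodalFormsKeyed`: (i) the nonsingularity radii of the two reference
pencils are the THEOREM `IsNodalFormWithNodes.exists_isNonsingularForm_add_smul`; (ii) the confluence is read by
`SignSymmetricPowersLinkConfluenceNKeyed.exists_confluence_at_of_nonComm_keyed` (two coefficients); (iii) the link is the two-coefficient lemma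
`exists_link_of_conjugate_confluence_of_ne₂`.  Proof otherwise verbatim.  CONDITIONAL; nothing here proves HC; rung F-H1 not moved.
-/

noncomputable section

set_option linter.dupNamespace false

open CategoryTheory MvPolynomial Topology
open Literature.AlgebraicTopology.SingularHomology
open Literature.AlgebraicGeometry.Motives Literature.AlgebraicGeometry.Motives.UniversalHypersurface
open Literature.AlgebraicGeometry.HodgeTheory Literature.AlgebraicGeometry.HodgeTheory.UniversalHypersurface
open Literature.AlgebraicGeometry.HodgeTheory.BettiUniverse
open Literature.AlgebraicGeometry.FundamentalGroup
open Summit.HodgeConjecture.HodgeConjecture.Theorems.SignSymmetricPowersMeridianOneNode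
open Summit.HodgeConjecture.HodgeConjecture.Theorems.SignSymmetricPowersMeridianChart
open Summit.HodgeConjecture.HodgeConjecture.Theorems.SignSymmetricPowersLinkConjugacy
open Summit.HodgeConjecture.HodgeConjecture.Theorems.SignSymmetricPowersLinkTransport
open Summit.HodgeConjecture.HodgeConjecture.Theorems.SignSymmetricPowersLinkConfluence
open Summit.HodgeConjecture.HodgeConjecture.Theorems.SignSymmetricPowersLinkPairConjugacy
open Summit.HodgeConjecture.HodgeConjecture.Theorems.SignSymmetricPowersLinkSameFactor
open Summit.HodgeConjecture.HodgeConjecture.Theorems.SignSymmetricPowersGenFactors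
open Summit.HodgeConjecture.HodgeConjecture.Theorems.SignSymmetricPowersPencilTransport
open Summit.HodgeConjecture.HodgeConjecture.Theorems.SignSymmetricPowersConfluenceLinkG

namespace Summit.HodgeConjecture.HodgeConjecture.Theorems.SignSymmetricPowersConfluenceLinkGNKeyed

/-- **LINK-G from {hPL₁, hPL₂exch, hN}** (keyed binders): verbatim `SignSymmetricPowersConfluenceLinkGN.signConfluenceLinkG_of_nonComm` with the
uniform Picard–Lefschetz antecedent replaced by `picardLefschetz_oneNode → picardLefschetz_exchangedPair →`; radii from
`IsNodalFormWithNodes.exists_isNonsingularForm_add_smul`, confluence from `exists_confluence_at_of_nonComm_keyed`, link from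
`exists_link_of_conjugate_confluence_of_ne₂`.  CONDITIONAL; HC not proved.
[cite: ArnoldGuseinzadeVarchenko2012, Part I §5.2] [cite: Shimada2010ZvK, §3 Prop. 3.4] [cite: Deligne1974, proof of Thm. (5.4), p. 291]
[cite: VoisinHodgeII2003, §3.2.1 Thm. 3.16 and §3.2.2] -/
theorem signConfluenceLinkG_of_nonComm_keyed :
    open Literature.AlgebraicGeometry.Motives Literature.AlgebraicGeometry.Motives.UniversalHypersurface Literature.AlgebraicGeometry.HodgeTheory Literature.AlgebraicGeometry.HodgeTheory.UniversalHypersurface Literature.AlgebraicGeometry.HodgeTheory.BettiUniverse CategoryTheory.Limits in (∀ (n d : ℕ), 2 ≤ d → ∃ Disc : MvPolynomial (Literature.AlgebraicGeometry.Motives.UniversalHypersurface.DegIndex n d) ℂ, Irreducible Disc ∧ Disc.IsHomogeneous Disc.totalDegree ∧ 0 < Disc.totalDegree ∧ ∀ a : Literature.AlgebraicGeometry.Motives.UniversalHypersurface.DegIndex n d → ℂ, a ∈ Literature.AlgebraicGeometry.HodgeTheory.singularCoeffs n d ↔ MvPolynomial.eval a Disc = 0) → (∀ (n d : ℕ) (f₁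 g₀ g₂ : MvPolynomial (Fin (n + 2)) ℂ) (j k : Fin (n + 2)) (a : Fin (n + 2) → ℂˣ), 1 ≤ n → 1 ≤ d → f₁.IsHomogeneous d → g₀.IsHomogeneous d → g₂.IsHomogeneous d → Literature.AlgebraicGeometry.HodgeTheory.IsSymmetricA3Datum f₁ g₀ g₂ j k a → ∀ (εa εb : ℝ) (ψ : ℂ → ℂ), Literature.AlgebraicGeometry.HodgeTheory.IsSymmetricA3Bifurcation f₁ g₀ g₂ j a εa εb ψ → ∃ εa' : ℝ, 0 < εa' ∧ εa' ≤ εa ∧ Literature.AlgebraicGeometry.HodgeTheory.SymmetricA3NonCommutation n d f₁ g₀ g₂ ψ εa') → Literature.AlgebraicGeometry.FundamentalGroup.affineHypersurfaceComplement_meridian_isConj → discriminant_localBranches_nodal → picardLefschetz_oneNode → picardLefschetz_exchangedPair → ∀ ⦃d : ℕ⦄, Even d → ∀ (h4 : 4 ≤ d), (let M : Set (DegIndex 3 d) := {m | Even (m.1 0 + m.1 1)}; let γ : Fin 5 → ℂˣ := fun i => if (i : ℕ) < 2 then -1 else 1; let u := familyM ℂ 3 d M; let hu : IsSmoothProjectiveFamily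 u 3 := isSmoothProjectiveFamily_familyM ℂ 3 d M (by decide) (le_trans (by decide) h4); let hU : IsCohomologicallyLocallyTrivialOn u (Set.univ : Set (ComplexPoints (baseM ℂ 3 d M))) := isCohomologicallyLocallyTrivialOn_familyM 3 d M (by decide) (le_trans (by decide) h4); let toU : C(ComplexPoints (baseM ℂ 3 d M), (Set.univ : Set (ComplexPoints (baseM ℂ 3 d M)))) := ⟨fun s => ⟨s, Set.mem_univ s⟩, continuous_id.subtype_mk _⟩; ∀ (hγ : FixesMonomials ℂ 3 d M γ) (t₀ : ComplexPoints (baseM ℂ 3 d M)) (f : MvPolynomial (Fin 5) ℂ) (hf : f.IsHomogeneous d) (hM : IsSupportedOn 3 d M f) (hJ : SmoothHypersurface.IsNonsingularForm ℂ f), let t := classifyingPoint ℂ 3 d M t₀ f; let Y := fiberOver u t; let hY : IsSmoothProjective 3 Y := hu.isSmoothProjective t; let B : LinearMap.BilinForm ℚ (bettiCohomology Y 3) := (cup Y 3 3).compr₂ (tr hY (3 + 3)); let τ : bettiCohomology Y 3 →ₗ[ℚ] bettiCohomology Y 3 := pull (sigmaMFiber ℂ 3 d M γ hγ t) 3; let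 Γ := (haveI := finite hY 3; ratMonodromyGroup u 3 hU ⟨t, Set.mem_univ _⟩); τ ^ 2 = 1 → (∀ x y, B (τ x) (τ y) = B x y) → (∀ g ∈ Γ, ∀ x, g (τ x) = τ (g x)) → (∀ g ∈ Γ, ∀ x y, B (g x) (g y) = B x y) → ∀ (p : Fin 5 → ℂ), (p = ![0, 0, 0, 0, 1] ∨ p = ![1, 0, 0, 0, 0]) → ∀ (f₁ g : MvPolynomial (Fin 5) ℂ), f₁.IsHomogeneous d → g.IsHomogeneous d → IsSupportedOn 3 d M f₁ → IsSupportedOn 3 d M g → IsNodalFormWithNodes f₁ ![p] → (∀ i : Fin 1, MvPolynomial.eval (![p] i) g ≠ 0) → ∀ (f₃ g₃ : MvPolynomial (Fin 5) ℂ), f₃.IsHomogeneous d → g₃.IsHomogeneous d → IsSupportedOn 3 d M f₃ → IsSupportedOn 3 d M g₃ → IsNodalFormWithNodes f₃ ![![1, 0, 1, 0, 0], ![-1, 0, 1, 0, 0]] → (∀ i : Fin 2, MvPolynomial.eval (![![1, 0, 1, 0, 0], ![-1, 0, 1, 0, 0]] i) g₃ ≠ 0) → ∃ ε₁ : ℝ,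 0 < ε₁ ∧ ∀ ε ε' : ℝ, 0 < ε → ε < ε₁ → 0 < ε' → ε' < ε₁ → ∀ (s : ComplexPoints (baseM ℂ 3 d M)) (β : Path t s) (ω : Path s s), pointFormM ℂ 3 d M s = f₁ + ((ε : ℝ) : ℂ) • g → IsPencilCircle 3 d f₁ g ε (ω.map (AlgPoints.mapContinuous (toBase ℂ 3 d M)).continuous) → ∀ (s' : ComplexPoints (baseM ℂ 3 d M)) (β' : Path t s') (ω' : Path s' s'), pointFormM ℂ 3 d M s' = f₃ + ((ε' : ℝ) : ℂ) • g₃ → IsPencilCircle 3 d f₃ g₃ ε' (ω'.map (AlgPoints.mapContinuous (toBase ℂ 3 d M)).continuous) → ∀ T : bettiCohomology Y 3 ≃ₗ[ℚ] bettiCohomology Y 3, IsRatTransport u 3 hU ⟦((β.trans ω).trans β.symm).map toU.continuous⟧ T → ∀ T' : bettiCohomology Y 3 ≃ₗ[ℚ] bettiCohomology Y 3, IsRatTransport u 3 hU ⟦((β'.trans ω').trans β'.symm).map toU.continuous⟧ T' → ∀ (r δ : bettiCohomology Y 3) (c c' : ℚ) (hr : B r r = 0) (hδ : B δ δ = 0)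 (hδ' : B (τ δ) (τ δ) = 0), (τ r = r ∨ τ r = -r) → B δ (τ δ) = 0 → T = oneParamTransvectionEquiv B hr c → T' = oneParamTransvectionEquiv B hδ c' * oneParamTransvectionEquiv B hδ' c' → ∃ g ∈ Γ, B r (g δ) ≠ 0) := by
  intro hD0 hNC hMC hD1 hPL1 hPL2 d hd h4 M γ u hu hU toU hγ t₀ f hf hM hJ t Y hY B τ Γ hτ2 hτB hΓτ hΓB p hp f₁ g hf₁ hg
    hM₁ hMg hnod hgp f₃ g₃ hf₃ hg₃ hM₃ hMg₃ hnod₃ hgp₃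
  have hd1 : 1 ≤ d := le_trans (by decide) h4
  have hd2 : 2 ≤ d := le_trans (by decide) h4
  -- the nonsingularity radii of the two pencils (clause (i) of F-PL is the theorem of `NodalFormPencilNonsingular`)
  obtain ⟨ε₀, hε₀, hsm⟩ := hnod.exists_isNonsingularForm_add_smul hd1 hf₁ hg hgp
  obtain ⟨ε₀', hε₀', hsm'⟩ := hnod₃.exists_isNonsingularForm_add_smul hd1 hf₃ hg₃ hgp₃
  refine ⟨min ε₀ ε₀', lt_min hε₀ hε₀', ?_⟩
  intro ε ε' hε hεε hε' hε'ε s β ω hs hω s' β' ω' hs' hω' T hT T' hT' r δ c c' hr hδ hδ' hτr hBδτ hTeq hT'eq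
  have hns : ∀ cc : ℂ, cc ≠ 0 → ‖cc‖ ≤ ε → SmoothHypersurface.IsNonsingularForm ℂ (f₁ + cc • g) :=
    fun cc hcc hccε => hsm cc hcc (lt_of_le_of_lt hccε (hεε.trans_le (min_le_left _ _)))
  have hns' : ∀ cc : ℂ, cc ≠ 0 → ‖cc‖ ≤ ε' → SmoothHypersurface.IsNonsingularForm ℂ (f₃ + cc • g₃) :=
    fun cc hcc hccε => hsm' cc hcc (lt_of_le_of_lt hccε (hε'ε.trans_le (min_le_right _ _)))
  classical
  -- an irreducible equation of the discriminant, and the distinct prime factors of its restriction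
  obtain ⟨Disc, hirr, -, -, hV⟩ := hD0 3 d hd2
  have hDne : killHom ℂ 3 d M Disc ≠ 0 := by
    intro h0
    have ht : (coeffVector ℂ 3 d (AlgPoints.map (toBase ℂ 3 d M) t)) ∘ (Subtype.val : M → DegIndex 3 d) ∈
        Set.range (fun t : ComplexPoints (baseM ℂ 3 d M) =>
          (coeffVector ℂ 3 d (AlgPoints.map (toBase ℂ 3 d M) t)) ∘ (Subtype.val : M → DegIndex 3 d)) := ⟨t, rfl⟩
    rw [range_coeffChart_eq 3 d M hV, Set.mem_setOf_eq, h0, map_zero] at ht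
    exact ht rfl
  obtain ⟨m, h, e, w, hw, hirrh, hna, he, hfac, -⟩ := exists_distinct_irreducible_factors (killHom ℂ 3 d M Disc) hDne
  -- the symmetric `A₃` datum for `p`, with `g₀ := x_j^d`
  obtain ⟨n', hn'⟩ : ∃ n', d = 2 * n' + 4 := by
    obtain ⟨k, hk⟩ := hd
    exact ⟨k - 2, by omega⟩
  have hXst : ∀ j : Fin 5, γ ∈ diagonalStabilizer (X j ^ d : MvPolynomial (Fin 5) ℂ) := fun j =>
    signUnits_two_mem_diagonalStabilizer _ (coeff_X_pow_eq_zero_of_odd hd j)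
  have hX1 : ∀ j : Fin 5, MvPolynomial.eval (Pi.single j (1 : ℂ)) (X j ^ d : MvPolynomial (Fin 5) ℂ) ≠ 0 :=
    fun j => by rw [map_pow, eval_X, Pi.single_eq_same, one_pow]; exact one_ne_zero
  obtain ⟨fA, g₂A, j, k, hfA, hg₂A, hevfA, hevg₂A, hDat, hpj⟩ : ∃ (fA g₂A : MvPolynomial (Fin 5) ℂ) (j k : Fin 5),
      fA.IsHomogeneous d ∧ g₂A.IsHomogeneous d ∧ (∀ e : Fin 5 →₀ ℕ, ¬ Even (e 0 + e 1) → fA.coeff e = 0) ∧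
      (∀ e : Fin 5 →₀ ℕ, ¬ Even (e 0 + e 1) → g₂A.coeff e = 0) ∧
      IsSymmetricA3Datum fA (X j ^ d) g₂A j k γ ∧ p = Pi.single j 1 := by
    rcases hp with hp | hp
    · obtain ⟨fA, g₀A, g₂A, hfA, -, hg₂A, hevf, -, hevg₂, hDat⟩ :=
        SignSymmetricPowersSymmetricA3Plane.exists_symmetricA3Datum_plane n'
      refine ⟨fA, g₂A, 4, 0, by rw [hn']; exact hfA, by rw [hn']; exact hg₂A, hevf, hevg₂,
        isSymmetricA3Datum_replace_g₀ hDat (hX1 4) (hXst 4), ?_⟩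
      rw [hp]; funext i; fin_cases i <;> simp
    · obtain ⟨fA, g₀A, g₂A, hfA, -, hg₂A, hevf, -, hevg₂, hDat⟩ :=
        SignSymmetricPowersSymmetricA3Line.exists_symmetricA3Datum_line n'
      refine ⟨fA, g₂A, 0, 2, by rw [hn']; exact hfA, by rw [hn']; exact hg₂A, hevf, hevg₂,
        isSymmetricA3Datum_replace_g₀ hDat (hX1 0) (hXst 0), ?_⟩
      rw [hp]; funext i; fin_cases i <;> simp
  have hXh : (X j ^ d : MvPolynomial (Fin 5) ℂ).IsHomogeneous d := by simpa using (isHomogeneous_X ℂ j).pow d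
  have hXM : IsSupportedOn 3 d M (X j ^ d : MvPolynomial (Fin 5) ℂ) :=
    isSupportedOn_of_coeff_odd_eq_zero (coeff_X_pow_eq_zero_of_odd hd j)
  have hfAM : IsSupportedOn 3 d M fA := isSupportedOn_of_coeff_odd_eq_zero hevfA
  have hg₂AM : IsSupportedOn 3 d M g₂A := isSupportedOn_of_coeff_odd_eq_zero hevg₂A
  -- the confluence read at `t`
  obtain ⟨F₁, F₂, G₁, G₂, q, ε₂, s₂, κ, ω₁, ω₂, T₁, T₂, e₁, e₂, e₃, c₁, c₂, hF₁h, hF₂h, hG₁h, hG₂h, hF₁M, hF₂M, hG₁M, hG₂M,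
    hnodF₁, hG₁e, hnodF₂, hG₂q, hε₂, hns₁, hns₂, hs₁, hs₂, hpc₁, hpc₂, hT₁, hT₂, h13, hBw, hT₁x, hT₂x⟩ :=
    SignSymmetricPowersLinkConfluenceNKeyed.exists_confluence_at_of_nonComm_keyed 3 d M γ hPL1 hPL2 hNC (by norm_num) hd1
      ⟨1, by norm_num⟩ hγ hU hfA hXh hg₂A hfAM hXM hg₂AM hDat
      (fun q' h0 i => eval_pderiv_X_pow_eq_zero hd2 j q' h0 i) t
  -- one-node conjugacy: `T₁ = γ₁ T γ₁⁻¹`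
  have hgp' : MvPolynomial.eval (Pi.single j (1 : ℂ)) g ≠ 0 := by
    have := hgp 0; rwa [Matrix.cons_val_fin_one, hpj] at this
  have hnod' : IsNodalFormWithNodes f₁ ![Pi.single j (1 : ℂ)] := by rw [← hpj]; exact hnod
  obtain ⟨γ₁, hγ₁, hc₁⟩ := exists_conj_transport_of_node_at 3 d M hMC hD1 hirr hV (by norm_num) hd1 hw hirrh he hfac hU
    hf₁ hg hF₁h hG₁h hM₁ hMg hF₁M hG₁M hnod' hnodF₁ hgp' hG₁e hε hε₂ hns hns₁ β hs ω hω κ hs₁ ω₁ hpc₁ hT hT₁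
  -- pair conjugacy: `T₂ = γ₂ T' γ₂⁻¹`
  obtain ⟨j₀, hj₀⟩ := exists_factor_of_free_singular hd2 hV hw h he hfac
  have hqplus : IsOrdinaryDoublePointOf f₃ ![1, 0, 1, 0, 0] := by have := hnod₃.1 0; rwa [Matrix.cons_val_zero] at this
  have hqF : IsOrdinaryDoublePointOf F₂ q := by have := hnodF₂.1 0; rwa [Matrix.cons_val_zero] at this
  obtain ⟨⟨i₀, hi₀, hq₀⟩, ⟨i₁, hi₁, hq₁⟩⟩ := free_of_isNodalFormWithNodes_pair hnodF₂
  have h01 : q 0 ≠ 0 ∨ q 1 ≠ 0 := by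
    have hcase : (i₀ : ℕ) = 0 ∨ (i₀ : ℕ) = 1 := by omega
    rcases hcase with h0 | h0
    · left; have hi : i₀ = 0 := Fin.ext h0; rwa [hi] at hq₀
    · right; have hi : i₀ = 1 := Fin.ext h0; rwa [hi] at hq₀
  have h234 : q 2 ≠ 0 ∨ q 3 ≠ 0 ∨ q 4 ≠ 0 := by
    have hcase : (i₁ : ℕ) = 2 ∨ (i₁ : ℕ) = 3 ∨ (i₁ : ℕ) = 4 := by have := i₁.isLt; omega
    rcases hcase with h0 | h0 | h0
    · left; have hi : i₁ = 2 := Fin.ext h0; rwa [hi] at hq₁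
    · right; left; have hi : i₁ = 3 := Fin.ext h0; rwa [hi] at hq₁
    · right; right; have hi : i₁ = 4 := Fin.ext h0; rwa [hi] at hq₁
  have hsame : ∃ jj, MvPolynomial.eval (fun m' : M => coeff m'.1.1 f₃) (h jj) = 0 ∧
      MvPolynomial.eval (fun m' : M => coeff m'.1.1 F₂) (h jj) = 0 :=
    ⟨j₀, hj₀ f₃ ![1, 0, 1, 0, 0] hf₃ hM₃ (Or.inl (by simp)) (Or.inl (by simp)) hqplus.eval_pderiv,
      hj₀ F₂ q hF₂h hF₂M h01 h234 hqF.eval_pderiv⟩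
  have hgp₃' : MvPolynomial.eval ![1, 0, 1, 0, 0] g₃ ≠ 0 := by have := hgp₃ 0; rwa [Matrix.cons_val_zero] at this
  have hG₂q0 : MvPolynomial.eval q G₂ ≠ 0 := by have := hG₂q 0; rwa [Matrix.cons_val_zero] at this
  have hG₂q1 : MvPolynomial.eval (fun i => (γ i : ℂ) * q i) G₂ ≠ 0 := by
    have := hG₂q 1; rwa [Matrix.cons_val_one, Matrix.cons_val_fin_one] at this
  obtain ⟨γ₂, hγ₂, hc₂⟩ := exists_conj_transport_of_pairs hMC hD1 hd1 hirr hV hγ hw hirrh hna he hfac hU hf₃ hg₃ hM₃ hMg₃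
    hnod₃ hgp₃' hF₂h hG₂h hF₂M hG₂M hnodF₂ hG₂q0 hG₂q1 hsame hε' hε₂ hns' hns₂ β' hs' ω' hω' κ hs₂ ω₂ hpc₂ hT' hT₂
  -- the LINK algebra
  have hBdef : B = (cup Y 3 3).compr₂ (tr hY (3 + 3)) := rfl
  have hBalt : B.IsAlt := isAlt_tr_cup_of_odd hY ⟨1, by norm_num⟩
  have hBn : B.Nondegenerate := nondegenerate_tr_cup hY
  have h13' : B e₁ e₃ = 0 := by rw [hBdef, LinearMap.compr₂_apply]; exact h13
  have hBw' : c₁ * B e₂ ((c₂ * B e₂ e₃) • e₃ + (c₂ * B e₂ e₁) • e₁) ≠ 0 := by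
    simp only [hBdef, LinearMap.compr₂_apply]; exact hBw
  have h31 : B e₃ e₁ = 0 := by rw [← hBalt.neg_eq, h13', neg_zero]
  have hT₁eq : T₁ = oneParamTransvectionEquiv B (hBalt e₂) c₁ := LinearEquiv.ext fun x => by
    rw [hT₁x x, oneParamTransvectionEquiv_apply, hBdef, LinearMap.compr₂_apply]
  have hT₂eq : T₂ = oneParamTransvectionEquiv B (hBalt e₁) c₂ * oneParamTransvectionEquiv B (hBalt e₃) c₂ :=
    LinearEquiv.ext fun x => by
      rw [hT₂x x, oneParamTransvectionEquiv_mul_apply_of_orthogonal B (hBalt e₁) (hBalt e₃) h31 c₂ x, hBdef,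
        LinearMap.compr₂_apply, LinearMap.compr₂_apply]
  have hTfin : oneParamTransvectionEquiv B (hBalt r) c =
      γ₁⁻¹ * oneParamTransvectionEquiv B (hBalt e₂) c₁ * (γ₁⁻¹)⁻¹ := by
    have h1 : T = γ₁⁻¹ * T₁ * γ₁⁻¹⁻¹ := eq_inv_conj_of_eq_conj hc₁
    rw [hT₁eq] at h1
    exact hTeq.symm.trans h1
  have hT'fin : oneParamTransvectionEquiv B (hBalt δ) c' * oneParamTransvectionEquiv B (hBalt (τ δ)) c' =
      γ₂⁻¹ * (oneParamTransvectionEquiv B (hBalt e₁) c₂ * oneParamTransvectionEquiv B (hBalt e₃) c₂) * (γ₂⁻¹)⁻¹ := by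
    have h1 : T' = γ₂⁻¹ * T₂ * γ₂⁻¹⁻¹ := eq_inv_conj_of_eq_conj hc₂
    rw [hT₂eq] at h1
    exact hT'eq.symm.trans h1
  exact exists_link_of_conjugate_confluence_of_ne₂ hBalt hBn hτ2 hτB hΓτ hΓB h13' hBw' hτr
    (inv_mem hγ₁) (inv_mem hγ₂) hTfin hT'fin

end Summit.HodgeConjecture.HodgeConjecture.Theorems.SignSymmetricPowersConfluenceLinkGNKeyed

end
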